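import Summits.Parity.GeneralizedHardyLittlewood.Theorems.GreenTaoLevelTwoMNTwoVerticalTruncation
import Summits.Parity.GeneralizedHardyLittlewood.Theorems.GreenTaoLevelTwoMNTwoVerticalWeightsExplicit
import HarnessLib

/-!
# Route `GreenTaoLevelTwo`, crux `MNTwo` (stmt-Parity-21276), line `birth`: the vertical
# approximation along a central frame (the harmonic-analysis core of `stub_verticalReduction`, VII)

Assembly of the harmonic-analysis layer of Green–Tao 2012a Lemma 3.7 from the previous files
(`…VerticalComponents`, `…VerticalSmoothing`, `…VerticalMultiplier`, `…VerticalTruncation`,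
`…VerticalWeights`, `…VerticalWeightsExplicit`): along a central frame `ι : ℝ^I ↠ Z(G)` of
`Y = (G/Γ, d)` (translations `L`-Lipschitz, displacement `≤ L‖t‖`), for a `1`-bounded
`M`-Lipschitz `F`, the double smoothing `G = S_r S_r F` and its vertical Fourier components
`G_m` (`m ∈ ℤ^I`) satisfy

* `G_m = Re G_m + i Im G_m` with `Re G_m`, `Im G_m` `1`-bounded and `L³M`-Lipschitz, and
  `(Re G_m, Im G_m)` a vertical character in the skeleton's sense (`components_boundedLipschitz`,
  `components_isVertical`);
* POINTWISE APPROXIMATION (`norm_sub_sum_box_le`): for `r ≠ 0`, `r ≥ 0`, and every box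
  `[-K,K]^I`, `|F(x) − ∑_{m ∈ box} G_m(x)| ≤ M L r (1 + L) + |I| A^(|I|-1) T`,
  `A = 1 + Z/(π² r²)`, `T = Z (π² r²)⁻¹ (K+1)^(-1/2)`, `Z = ∑_k |k|^(-3/2)`.

The choice `r ≍ ε/(M L (1+L))`, `K ≍ (M/ε)^O(|I|)` and the packaging into the `happrox`
hypothesis of `…VerticalReductionBookkeeping.mnAt_of_verticalPoly_of_approx` are the last step.

References: B. Green, T. Tao, *The Möbius function is strongly orthogonal to nilsequences*,
Ann. of Math. 175 (2012), Lemma 3.7 and App. A [GreenTao2012Mobius].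
-/

noncomputable section

open MeasureTheory
open Literature.NumberTheory.Sieve
open Summit.Parity.GeneralizedHardyLittlewood.GreenTaoLevelTwoMNTwoVerticalComponents
open Summit.Parity.GeneralizedHardyLittlewood.GreenTaoLevelTwoMNTwoVerticalSmoothing
open Summit.Parity.GeneralizedHardyLittlewood.GreenTaoLevelTwoMNTwoVerticalMultiplier
open Summit.Parity.GeneralizedHardyLittlewood.GreenTaoLevelTwoMNTwoVerticalTruncation
open Summit.Parity.GeneralizedHardyLittlewood.GreenTaoLevelTwoMNTwoVerticalWeights
open Summit.Parity.GeneralizedHardyLittlewood.GreenTaoLevelTwoMNTwoVerticalWeightsExplicit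

namespace Summit.Parity.GeneralizedHardyLittlewood.GreenTaoLevelTwoMNTwoVerticalApproximation

variable {s : ℕ} (Y : Nilmanifold s) {I : Type} [Fintype I] (ι : (I → ℝ) → Y.G)

/-! ### §1 The double smoothing and its components -/

/-- **The double smoothing `G = S_r S_r F` is `1`-bounded and `L²M`-Lipschitz.**
[cite: GreenTao2012Mobius, Lemma 3.7] -/
theorem isBoundedLipschitz_smooth_smooth (hcont : Continuous ι) {L M : ℝ} (hM : 0 ≤ M) (hL : 0 ≤ L)
    (hlip : ∀ (t : I → ℝ) (p q : Y.G ⧸ Y.Γ), Y.dist (ι t • p) (ι t • q) ≤ L * Y.dist p q)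
    {F : Y.G ⧸ Y.Γ → ℝ} (hF : Y.IsBoundedLipschitz M F) (r : ℝ) :
    Y.IsBoundedLipschitz (L * (L * M)) fun y => (∫ σ : UnitAddTorus I, ∫ σ' : UnitAddTorus I, F (ι (fun i => r * (AddCircle.equivIco (1 : ℝ) 0 (σ' i) : ℝ)) • (ι (fun i => r * (AddCircle.equivIco (1 : ℝ) 0 (σ i) : ℝ)) • y)) ∂(Measure.pi fun _ : I => AddCircle.haarAddCircle) ∂(Measure.pi fun _ : I => AddCircle.haarAddCircle)) := by
  have hSF := isBoundedLipschitz_smooth Y ι hcont hM hlip hF r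
  exact isBoundedLipschitz_smooth Y ι hcont (mul_nonneg hL hM) hlip hSF r

/-- **The components `Re G_m`, `Im G_m` are `1`-bounded and `L³M`-Lipschitz.**
[cite: GreenTao2012Mobius, Lemma 3.7] -/
theorem components_boundedLipschitz (hadd : ∀ t u, ι (t + u) = ι t * ι u)
    (hcen : ∀ t, ι t ∈ Subgroup.center Y.G) (hΓ : ∀ n : I → ℤ, ι (fun i => (n i : ℝ)) ∈ Y.Γ)
    (hcont : Continuous ι) {L M : ℝ} (hM : 0 ≤ M) (hL : 0 ≤ L)
    (hlip : ∀ (t : I → ℝ) (p q : Y.G ⧸ Y.Γ), Y.dist (ι t • p) (ι t • q) ≤ L * Y.dist p q)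
    {F : Y.G ⧸ Y.Γ → ℝ} (hF : Y.IsBoundedLipschitz M F) (r : ℝ) (m : I → ℤ) :
    Y.IsBoundedLipschitz (L * (L * (L * M))) (fun x => (UnitAddTorus.mFourierCoeff (fun τ : UnitAddTorus I => (((∫ σ : UnitAddTorus I, ∫ σ' : UnitAddTorus I, F (ι (fun i => r * (AddCircle.equivIco (1 : ℝ) 0 (σ' i) : ℝ)) • (ι (fun i => r * (AddCircle.equivIco (1 : ℝ) 0 (σ i) : ℝ)) • (ι (fun i => (AddCircle.equivIco (1 : ℝ) 0 (τ i) : ℝ)) • x))) ∂(Measure.pi fun _ : I => AddCircle.haarAddCircle) ∂(Measure.pi fun _ : I => AddCircle.haarAddCircle)) : ℝ) : ℂ)) m).re) ∧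
    Y.IsBoundedLipschitz (L * (L * (L * M))) (fun x => (UnitAddTorus.mFourierCoeff (fun τ : UnitAddTorus I => (((∫ σ : UnitAddTorus I, ∫ σ' : UnitAddTorus I, F (ι (fun i => r * (AddCircle.equivIco (1 : ℝ) 0 (σ' i) : ℝ)) • (ι (fun i => r * (AddCircle.equivIco (1 : ℝ) 0 (σ i) : ℝ)) • (ι (fun i => (AddCircle.equivIco (1 : ℝ) 0 (τ i) : ℝ)) • x))) ∂(Measure.pi fun _ : I => AddCircle.haarAddCircle) ∂(Measure.pi fun _ : I => AddCircle.haarAddCircle)) : ℝ) : ℂ)) m).im) := by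
  have hG := isBoundedLipschitz_smooth_smooth Y ι hcont hM hL hlip hF r
  have hLM : 0 ≤ L * (L * M) := mul_nonneg hL (mul_nonneg hL hM)
  have hb : ∀ x, ‖UnitAddTorus.mFourierCoeff (fun τ : UnitAddTorus I => (((∫ σ : UnitAddTorus I, ∫ σ' : UnitAddTorus I, F (ι (fun i => r * (AddCircle.equivIco (1 : ℝ) 0 (σ' i) : ℝ)) • (ι (fun i => r * (AddCircle.equivIco (1 : ℝ) 0 (σ i) : ℝ)) • (ι (fun i => (AddCircle.equivIco (1 : ℝ) 0 (τ i) : ℝ)) • x))) ∂(Measure.pi fun _ : I => AddCircle.haarAddCircle) ∂(Measure.pi fun _ : I => AddCircle.haarAddCircle)) : ℝ) : ℂ)) m‖ ≤ 1 := fun x => norm_vComp_le_one Y ι hG.1 x m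
  have hl : ∀ x y, ‖UnitAddTorus.mFourierCoeff (fun τ : UnitAddTorus I => (((∫ σ : UnitAddTorus I, ∫ σ' : UnitAddTorus I, F (ι (fun i => r * (AddCircle.equivIco (1 : ℝ) 0 (σ' i) : ℝ)) • (ι (fun i => r * (AddCircle.equivIco (1 : ℝ) 0 (σ i) : ℝ)) • (ι (fun i => (AddCircle.equivIco (1 : ℝ) 0 (τ i) : ℝ)) • x))) ∂(Measure.pi fun _ : I => AddCircle.haarAddCircle) ∂(Measure.pi fun _ : I => AddCircle.haarAddCircle)) : ℝ) : ℂ)) m - UnitAddTorus.mFourierCoeff (fun τ : UnitAddTorus I => (((∫ σ : UnitAddTorus I, ∫ σ' : UnitAddTorus I, F (ι (fun i => r * (AddCircle.equivIco (1 : ℝ) 0 (σ' i) : ℝ)) • (ι (fun i => r * (AddCircle.equivIco (1 : ℝ) 0 (σ i) : ℝ)) • (ι (fun i => (AddCircle.equivIco (1 : ℝ) 0 (τ i) : ℝ)) • y))) ∂(Measure.pi fun _ : I => AddCircle.haarAddCircle) ∂(Measure.pi fun _ : I => AddCircle.haarAddCircle)) : ℝ) : ℂ)) m‖ ≤ L *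 (L * (L * M)) * Y.dist x y :=
    fun x y => norm_vComp_sub_vComp_le Y ι hadd hcen hΓ hcont hLM hlip hG x y m
  refine ⟨⟨fun x => ?_, fun x y => ?_⟩, ⟨fun x => ?_, fun x y => ?_⟩⟩
  · exact (Complex.abs_re_le_norm _).trans (hb x)
  · rw [← Complex.sub_re]
    exact (Complex.abs_re_le_norm _).trans (hl x y)
  · exact (Complex.abs_im_le_norm _).trans (hb x)
  · rw [← Complex.sub_im]
    exact (Complex.abs_im_le_norm _).trans (hl x y)

/-- **The components are vertical characters** (skeleton shape: `F₁ + iF₂` transforms under every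
central `z` by `e(θ(z))`). [cite: GreenTao2012Mobius, Def. 3.3–Lemma 3.7] -/
theorem components_isVertical (hadd : ∀ t u, ι (t + u) = ι t * ι u)
    (hcen : ∀ t, ι t ∈ Subgroup.center Y.G) (hΓ : ∀ n : I → ℤ, ι (fun i => (n i : ℝ)) ∈ Y.Γ)
    (hsurj : ∀ z ∈ Subgroup.center Y.G, ∃ t, ι t = z) (F : Y.G ⧸ Y.Γ → ℝ) (r : ℝ) (m : I → ℤ) :
    ∃ θ : Y.G → ℝ, ∀ z : Y.G, z ∈ Subgroup.center Y.G → ∀ x : Y.G ⧸ Y.Γ,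
      ((((fun x => (UnitAddTorus.mFourierCoeff (fun τ : UnitAddTorus I => (((∫ σ : UnitAddTorus I, ∫ σ' : UnitAddTorus I, F (ι (fun i => r * (AddCircle.equivIco (1 : ℝ) 0 (σ' i) : ℝ)) • (ι (fun i => r * (AddCircle.equivIco (1 : ℝ) 0 (σ i) : ℝ)) • (ι (fun i => (AddCircle.equivIco (1 : ℝ) 0 (τ i) : ℝ)) • x))) ∂(Measure.pi fun _ : I => AddCircle.haarAddCircle) ∂(Measure.pi fun _ : I => AddCircle.haarAddCircle)) : ℝ) : ℂ)) m).re) (z • x) : ℝ) : ℂ) +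
        (((fun x => (UnitAddTorus.mFourierCoeff (fun τ : UnitAddTorus I => (((∫ σ : UnitAddTorus I, ∫ σ' : UnitAddTorus I, F (ι (fun i => r * (AddCircle.equivIco (1 : ℝ) 0 (σ' i) : ℝ)) • (ι (fun i => r * (AddCircle.equivIco (1 : ℝ) 0 (σ i) : ℝ)) • (ι (fun i => (AddCircle.equivIco (1 : ℝ) 0 (τ i) : ℝ)) • x))) ∂(Measure.pi fun _ : I => AddCircle.haarAddCircle) ∂(Measure.pi fun _ : I => AddCircle.haarAddCircle)) : ℝ) : ℂ)) m).im) (z • x) : ℝ) : ℂ) * Complex.I) =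
      Complex.exp (2 * Real.pi * Complex.I * θ z) *
        ((((fun x => (UnitAddTorus.mFourierCoeff (fun τ : UnitAddTorus I => (((∫ σ : UnitAddTorus I, ∫ σ' : UnitAddTorus I, F (ι (fun i => r * (AddCircle.equivIco (1 : ℝ) 0 (σ' i) : ℝ)) • (ι (fun i => r * (AddCircle.equivIco (1 : ℝ) 0 (σ i) : ℝ)) • (ι (fun i => (AddCircle.equivIco (1 : ℝ) 0 (τ i) : ℝ)) • x))) ∂(Measure.pi fun _ : I => AddCircle.haarAddCircle) ∂(Measure.pi fun _ : I => AddCircle.haarAddCircle)) : ℝ) : ℂ)) m).re) x : ℝ) : ℂ) +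
          (((fun x => (UnitAddTorus.mFourierCoeff (fun τ : UnitAddTorus I => (((∫ σ : UnitAddTorus I, ∫ σ' : UnitAddTorus I, F (ι (fun i => r * (AddCircle.equivIco (1 : ℝ) 0 (σ' i) : ℝ)) • (ι (fun i => r * (AddCircle.equivIco (1 : ℝ) 0 (σ i) : ℝ)) • (ι (fun i => (AddCircle.equivIco (1 : ℝ) 0 (τ i) : ℝ)) • x))) ∂(Measure.pi fun _ : I => AddCircle.haarAddCircle) ∂(Measure.pi fun _ : I => AddCircle.haarAddCircle)) : ℝ) : ℂ)) m).im) x : ℝ) : ℂ) * Complex.I) := by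
  have h := vComp_isVertical Y ι hadd hcen hΓ hsurj (fun y => (∫ σ : UnitAddTorus I, ∫ σ' : UnitAddTorus I, F (ι (fun i => r * (AddCircle.equivIco (1 : ℝ) 0 (σ' i) : ℝ)) • (ι (fun i => r * (AddCircle.equivIco (1 : ℝ) 0 (σ i) : ℝ)) • y)) ∂(Measure.pi fun _ : I => AddCircle.haarAddCircle) ∂(Measure.pi fun _ : I => AddCircle.haarAddCircle))) m
  simp only at h ⊢
  exact h

/-! ### §2 Pointwise approximation by the box-truncated vertical expansion -/

/-- **Pointwise approximation** (Green–Tao 2012a Lemma 3.7, quantitative core): for `r > 0` and a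
box `[-K,K]^I` of frequencies,
`|F(x) − ∑_(m ∈ box) G_m(x)| ≤ M L r + L M L r + |I| A^(|I|-1) T` with `A = 1 + Z/(π² r²)`,
`T = Z (π² r²)⁻¹ (K+1)^(-1/2)`. [cite: GreenTao2012Mobius, Lemma 3.7 and App. A] -/
theorem norm_sub_sum_box_le [DecidableEq I] (hadd : ∀ t u, ι (t + u) = ι t * ι u)
    (hcen : ∀ t, ι t ∈ Subgroup.center Y.G) (hΓ : ∀ n : I → ℤ, ι (fun i => (n i : ℝ)) ∈ Y.Γ)
    (hcont : Continuous ι) {L M : ℝ} (hM : 0 ≤ M) (hL : 0 ≤ L)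
    (hlip : ∀ (t : I → ℝ) (p q : Y.G ⧸ Y.Γ), Y.dist (ι t • p) (ι t • q) ≤ L * Y.dist p q)
    (hself : ∀ (t : I → ℝ) (p : Y.G ⧸ Y.Γ), Y.dist (ι t • p) p ≤ L * ‖t‖)
    {F : Y.G ⧸ Y.Γ → ℝ} (hF : Y.IsBoundedLipschitz M F) {r : ℝ} (hr0 : 0 ≤ r) (hr : r ≠ 0)
    (K : ℕ) (x : Y.G ⧸ Y.Γ) :
    ‖(F x : ℂ) - ∑ m ∈ (Fintype.piFinset fun _ : I => Finset.Icc (-(K : ℤ)) K), UnitAddTorus.mFourierCoeff (fun τ : UnitAddTorus I => (((∫ σ : UnitAddTorus I, ∫ σ' : UnitAddTorus I, F (ι (fun i => r * (AddCircle.equivIco (1 : ℝ) 0 (σ' i) : ℝ)) • (ι (fun i => r * (AddCircle.equivIco (1 : ℝ) 0 (σ i) : ℝ)) • (ι (fun i => (AddCircle.equivIco (1 : ℝ) 0 (τ i) : ℝ)) • x))) ∂(Measure.pi fun _ : I => AddCircle.haarAddCircle) ∂(Measure.pi fun _ : I => AddCircle.haarAddCircle)) : ℝ) : ℂ)) m‖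 ≤
      M * L * r + L * M * L * r +
        Fintype.card I * (1 + (1 / (Real.pi ^ 2 * r ^ 2)) * (∑' k : ℤ, |(k : ℝ)| ^ (-(3 / 2 : ℝ)))) ^ (Fintype.card I - 1) * ((1 / (Real.pi ^ 2 * r ^ 2)) * ((K : ℝ) + 1) ^ (-(1 / 2 : ℝ)) * (∑' k : ℤ, |(k : ℝ)| ^ (-(3 / 2 : ℝ)))) := by
  have hSF := isBoundedLipschitz_smooth Y ι hcont hM hlip hF r
  have hG := isBoundedLipschitz_smooth_smooth Y ι hcont hM hL hlip hF r
  -- (1) closeness of the smoothings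
  have h1 : |F x - (∫ σ : UnitAddTorus I, F (ι (fun i => r * (AddCircle.equivIco (1 : ℝ) 0 (σ i) : ℝ)) • x) ∂(Measure.pi fun _ : I => AddCircle.haarAddCircle))| ≤ M * L * r := by
    have h := abs_smooth_sub_self_le Y ι hcont hM hL hself hF hr0 x
    rwa [abs_sub_comm] at h
  have h2 : |(∫ σ : UnitAddTorus I, F (ι (fun i => r * (AddCircle.equivIco (1 : ℝ) 0 (σ i) : ℝ)) • x) ∂(Measure.pi fun _ : I => AddCircle.haarAddCircle)) - (∫ σ : UnitAddTorus I, ∫ σ' : UnitAddTorus I, F (ι (fun i => r * (AddCircle.equivIco (1 : ℝ) 0 (σ' i) : ℝ)) • (ι (fun i => r * (AddCircle.equivIco (1 : ℝ) 0 (σ i) : ℝ)) • x)) ∂(Measure.pi fun _ : I => AddCircle.haarAddCircle) ∂(Measure.pi fun _ : I => AddCircle.haarAddCircle))| ≤ L * M * L * r := by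
    have h := abs_smooth_sub_self_le Y ι hcont (mul_nonneg hL hM) hL hself hSF hr0 x
    simp only at h
    rwa [abs_sub_comm] at h
  have h12 : |F x - (∫ σ : UnitAddTorus I, ∫ σ' : UnitAddTorus I, F (ι (fun i => r * (AddCircle.equivIco (1 : ℝ) 0 (σ' i) : ℝ)) • (ι (fun i => r * (AddCircle.equivIco (1 : ℝ) 0 (σ i) : ℝ)) • x)) ∂(Measure.pi fun _ : I => AddCircle.haarAddCircle) ∂(Measure.pi fun _ : I => AddCircle.haarAddCircle))| ≤ M * L * r + L * M * L * r :=
    (abs_sub_le _ _ _).trans (add_le_add h1 h2)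
  -- (2) the torus function of `G` at `x`, as a continuous map, and its value at `0`
  have hGc : Continuous fun y : Y.G ⧸ Y.Γ => (∫ σ : UnitAddTorus I, ∫ σ' : UnitAddTorus I, F (ι (fun i => r * (AddCircle.equivIco (1 : ℝ) 0 (σ' i) : ℝ)) • (ι (fun i => r * (AddCircle.equivIco (1 : ℝ) 0 (σ i) : ℝ)) • y)) ∂(Measure.pi fun _ : I => AddCircle.haarAddCircle) ∂(Measure.pi fun _ : I => AddCircle.haarAddCircle)) := hG.continuous
  set f : C(UnitAddTorus I, ℂ) := ⟨fun τ : UnitAddTorus I => (((∫ σ : UnitAddTorus I, ∫ σ' : UnitAddTorus I, F (ι (fun i => r * (AddCircle.equivIco (1 : ℝ) 0 (σ' i) : ℝ)) • (ι (fun i => r * (AddCircle.equivIco (1 : ℝ) 0 (σ i) : ℝ)) • (ι (fun i => (AddCircle.equivIco (1 : ℝ) 0 (τ i) : ℝ)) • x))) ∂(Measure.pi fun _ : I => AddCircle.haarAddCircle) ∂(Measure.pi fun _ : I => AddCircle.haarAddCircle)) : ℝ) : ℂ),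
    Complex.continuous_ofReal.comp (continuous_torusFun Y ι hadd hcen hΓ hcont hGc x)⟩ with hfdef
  have hf0 : f 0 = (((∫ σ : UnitAddTorus I, ∫ σ' : UnitAddTorus I, F (ι (fun i => r * (AddCircle.equivIco (1 : ℝ) 0 (σ' i) : ℝ)) • (ι (fun i => r * (AddCircle.equivIco (1 : ℝ) 0 (σ i) : ℝ)) • x)) ∂(Measure.pi fun _ : I => AddCircle.haarAddCircle) ∂(Measure.pi fun _ : I => AddCircle.haarAddCircle)) : ℝ) : ℂ) := by
    have h0 := torusFun_zero Y ι hadd (fun y : Y.G ⧸ Y.Γ => (∫ σ : UnitAddTorus I, ∫ σ' : UnitAddTorus I, F (ι (fun i => r * (AddCircle.equivIco (1 : ℝ) 0 (σ' i) : ℝ)) • (ι (fun i => r * (AddCircle.equivIco (1 : ℝ) 0 (σ i) : ℝ)) • y)) ∂(Measure.pi fun _ : I => AddCircle.haarAddCircle) ∂(Measure.pi fun _ : I => AddCircle.haarAddCircle))) x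
    simp only at h0
    simp only [hfdef, ContinuousMap.coe_mk, h0]
  have hfsum : ∑ m ∈ (Fintype.piFinset fun _ : I => Finset.Icc (-(K : ℤ)) K), UnitAddTorus.mFourierCoeff f m = ∑ m ∈ (Fintype.piFinset fun _ : I => Finset.Icc (-(K : ℤ)) K), UnitAddTorus.mFourierCoeff (fun τ : UnitAddTorus I => (((∫ σ : UnitAddTorus I, ∫ σ' : UnitAddTorus I, F (ι (fun i => r * (AddCircle.equivIco (1 : ℝ) 0 (σ' i) : ℝ)) • (ι (fun i => r * (AddCircle.equivIco (1 : ℝ) 0 (σ i) : ℝ)) • (ι (fun i => (AddCircle.equivIco (1 : ℝ) 0 (τ i) : ℝ)) • x))) ∂(Measure.pi fun _ : I => AddCircle.haarAddCircle) ∂(Measure.pi fun _ : I => AddCircle.haarAddCircle)) : ℝ) : ℂ)) m := rfl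
  -- (3) domination of the coefficients by the squared product weights
  set w : ℤ → ℝ := fun k => (if k = 0 then (1 : ℝ) else min 1 (1 / (Real.pi * |r| * |(k : ℝ)|))) ^ 2
    with hwdef
  have hdom : ∀ m : I → ℤ, ‖UnitAddTorus.mFourierCoeff f m‖ ≤ ∏ i, w (m i) := by
    intro m
    have h := norm_vComp_smooth_smooth_le Y ι hadd hcen hΓ hcont hM hlip hF hr x m
    simp only at h
    simp only [hwdef]
    rw [Finset.prod_pow]
    exact h
  have hw0 : ∀ k, 0 ≤ w k := fun k => sq_nonneg _
  have hA : ∀ K' : ℕ, ∑ k ∈ Finset.Icc (-(K' : ℤ)) K', w k ≤ (1 + (1 / (Real.pi ^ 2 * r ^ 2)) * (∑' k : ℤ, |(k : ℝ)| ^ (-(3 / 2 : ℝ)))) := fun K' => sum_Icc_weight_le hr K'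
  have hT : ∀ K' : ℕ, ∑ k ∈ Finset.Icc (-(K' : ℤ)) K' \ Finset.Icc (-(K : ℤ)) K, w k ≤ ((1 / (Real.pi ^ 2 * r ^ 2)) * ((K : ℝ) + 1) ^ (-(1 / 2 : ℝ)) * (∑' k : ℤ, |(k : ℝ)| ^ (-(3 / 2 : ℝ)))) :=
    fun K' => sum_sdiff_weight_le hr K K'
  have hWsum : Summable fun m : I → ℤ => ∏ i, w (m i) := summable_prod_weight w hw0 hA
  -- (4) truncation and tail
  have htr := norm_apply_zero_sub_sum_le f hWsum hdom (Fintype.piFinset fun _ : I => Finset.Icc (-(K : ℤ)) K)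
  have htail := tsum_compl_box_le (I := I) w hw0 hA K hT
  -- (5) combine
  have hsplit : (F x : ℂ) - ∑ m ∈ (Fintype.piFinset fun _ : I => Finset.Icc (-(K : ℤ)) K), UnitAddTorus.mFourierCoeff (fun τ : UnitAddTorus I => (((∫ σ : UnitAddTorus I, ∫ σ' : UnitAddTorus I, F (ι (fun i => r * (AddCircle.equivIco (1 : ℝ) 0 (σ' i) : ℝ)) • (ι (fun i => r * (AddCircle.equivIco (1 : ℝ) 0 (σ i) : ℝ)) • (ι (fun i => (AddCircle.equivIco (1 : ℝ) 0 (τ i) : ℝ)) • x))) ∂(Measure.pi fun _ : I => AddCircle.haarAddCircle) ∂(Measure.pi fun _ : I => AddCircle.haarAddCircle)) : ℝ) : ℂ)) m =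
      ((F x - (∫ σ : UnitAddTorus I, ∫ σ' : UnitAddTorus I, F (ι (fun i => r * (AddCircle.equivIco (1 : ℝ) 0 (σ' i) : ℝ)) • (ι (fun i => r * (AddCircle.equivIco (1 : ℝ) 0 (σ i) : ℝ)) • x)) ∂(Measure.pi fun _ : I => AddCircle.haarAddCircle) ∂(Measure.pi fun _ : I => AddCircle.haarAddCircle)) : ℝ) : ℂ) + (f 0 - ∑ m ∈ (Fintype.piFinset fun _ : I => Finset.Icc (-(K : ℤ)) K), UnitAddTorus.mFourierCoeff f m) := by
    rw [hf0, hfsum]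
    push_cast
    ring
  rw [hsplit]
  refine (norm_add_le _ _).trans (add_le_add ?_ (htr.trans htail))
  rw [Complex.norm_real, Real.norm_eq_abs]
  exact h12

end Summit.Parity.GeneralizedHardyLittlewood.GreenTaoLevelTwoMNTwoVerticalApproximation
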